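import Literature.NumberTheory.EllipticCurves.HeegnerPointsImaginaryQuadraticProofs
import Mathlib.NumberTheory.NumberField.CMField
import HarnessLib

set_option linter.dupNamespace false -- `Summit.BirchSwinnertonDyer.BirchSwinnertonDyer.Theorems.…` (summit = sub)
set_option autoImplicit false

/-!
# Crux `EisensteinHeartFlatCMInertBadKPrime` (stmt-BirchSwinnertonDyer-21341), line `hsieh-lambda`, layer 2 —
# INSTANTIATION tranche 1a: the biquadratic field `L = K_CM · K′` is a CM field with two infinite places

Route `BiquadraticEisensteinDescent` (cell `pub/bsd-wall`, width seat `bsd-wall-cm-bed-w2`; lead `bsd-wall-cm-bed-p1`,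
`Cruxes/EisensteinHeartFlatCMInertBadKPrime/LAYER2-VOCAB-BRIEF.md`). THEOREMS ONLY (no definition, no named fact, no
`sorry`); supports stmt-BirchSwinnertonDyer-21341 as a helper; nothing about the crux's input or any case of BSD is
asserted. Sequels: `…BiquadraticPrimes.lean` (decomposition of `p`), `…BiquadraticCMType.lean` (complex conjugation
swaps the primes above `p`; `KatzCM.IsPAdicCMType`).

## Setting and what is proved

`K` is a number field and `L ⊇ K` an extension with `[L : K] = 2` (in the route: `K = K′` the imaginary quadratic
Heegner field, `L = K_CM · K′ = K′(√d_CM)`), `x ∈ L` a square root of a rational `a < 0` (`x = √d_CM`) NOT in `K`.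

* §1 `L` is totally complex as soon as `K` is (`isTotallyComplex_of_tower`); for `K` imaginary quadratic `[L : ℚ] = 4`
  (`finrank_eq_four`) and `L` has EXACTLY TWO infinite places (`card_infinitePlace_eq_two`,
  `exists_infinitePlace_pair` — the hypotheses `hw`/`huniv` of the landed V2 socket
  `…KatzHsiehDisplay.exists_span_C_mul_eq`).
* §2 `L` is a CM field in Mathlib's sense (`isCMField` — the `[IsCMField L]` of `KatzCM.exists_isBaseChangeLine` /
  `hsieh2014mu_prop49_exists_isMeasure`): the element `x · y` (`y ∈ K` anti-invariant under the complex conjugation of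
  the CM field `K`) is a non-rational element of the maximal real subfield `L⁺`, so `[L⁺ : ℚ] ≥ 2`, `[L : L⁺] ≤ 2`, and
  `[L : L⁺] ≠ 1` because `x ∉ L⁺`. Its complex conjugation restricts to that of `K` (`complexConj_algebraMap`) and
  negates `x` (`complexConj_sqrt`).

References: [NeukirchANT1999] Ch. I §2, Ch. III §1; [Hsieh2014mu] §1.1 (CM fields, `Σ`).
-/

noncomputable section

open scoped Classical NumberField Pointwise
open NumberField IsDedekindDomain Module

namespace Summit.BirchSwinnertonDyer.BirchSwinnertonDyer.Theorems.BiquadraticEisensteinDescentEisensteinHeartFlatCMInertBadKPrimeBiquadraticCMField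

open Literature.NumberTheory.EllipticCurves

variable {K L : Type} [Field K] [NumberField K] [Field L] [NumberField L] [Algebra K L]

/-! ### §1 Infinite places -/

omit [NumberField K] [NumberField L] in
/-- An extension of a totally complex number field is totally complex (a real place of `L` would restrict to a real
place of `K`). [cite: NeukirchANT1999, Ch. III §1] -/
theorem isTotallyComplex_of_tower [IsTotallyComplex K] : IsTotallyComplex L := by
  refine ⟨fun w ↦ ?_⟩
  rw [← InfinitePlace.not_isReal_iff_isComplex]
  intro hw
  have h := hw.comap (algebraMap K L)
  exact (InfinitePlace.not_isReal_iff_isComplex.mpr (IsTotallyComplex.isComplex (w.comap (algebraMap K L)))) h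

/-- `[L : ℚ] = 4` for a quadratic extension of a quadratic field. [cite: NeukirchANT1999, Ch. I §2] -/
theorem finrank_eq_four (hK : IsImaginaryQuadratic K) (h2 : finrank K L = 2) : finrank ℚ L = 4 := by
  rw [← Module.finrank_mul_finrank ℚ K L, hK.1, h2]

/-- **`L` has exactly two infinite places** (both complex): `[L : ℚ] = 4 = 2 · #{complex places}`.
[cite: NeukirchANT1999, Ch. III §1] -/
theorem card_infinitePlace_eq_two (hK : IsImaginaryQuadratic K) (h2 : finrank K L = 2) :
    Fintype.card (InfinitePlace L) = 2 := by
  haveI := hK.2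
  haveI : IsTotallyComplex L := isTotallyComplex_of_tower (K := K)
  have h := IsTotallyComplex.finrank L
  rw [finrank_eq_four hK h2] at h
  rw [InfinitePlace.card_eq_nrRealPlaces_add_nrComplexPlaces, IsTotallyComplex.nrRealPlaces_eq_zero, zero_add]
  omega

/-- The two infinite places `w₁ ≠ w₂` of `L`, in the shape `hw`/`huniv` consumed by the V2 socket
`…KatzHsiehDisplay.exists_span_C_mul_eq`. [cite: NeukirchANT1999, Ch. III §1] -/
theorem exists_infinitePlace_pair (hK : IsImaginaryQuadratic K) (h2 : finrank K L = 2) :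
    ∃ w₁ w₂ : InfinitePlace L, w₁ ≠ w₂ ∧ ∀ w : InfinitePlace L, w = w₁ ∨ w = w₂ := by
  have h := card_infinitePlace_eq_two hK h2
  rw [← Nat.card_eq_fintype_card, Nat.card_eq_two_iff] at h
  obtain ⟨w₁, w₂, hne, huniv⟩ := h
  refine ⟨w₁, w₂, hne, fun w ↦ ?_⟩
  have hw : w ∈ ({w₁, w₂} : Set (InfinitePlace L)) := by rw [huniv]; exact Set.mem_univ w
  simpa using hw

/-! ### §2 `L` is a CM field; its complex conjugation on `K` and on `x = √a` -/

/-- A complex number with negative real square is purely imaginary: `conj z = -z`. [folklore] -/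
theorem conj_eq_neg_of_sq_lt_zero {z : ℂ} {a : ℝ} (hz : z ^ 2 = a) (ha : a < 0) : starRingEnd ℂ z = -z := by
  apply Complex.ext
  · simp only [Complex.conj_re, Complex.neg_re]
    have hre : (z ^ 2).re = a := by rw [hz]; simp
    have him : (z ^ 2).im = 0 := by rw [hz]; simp
    rw [sq, Complex.mul_im] at him
    rw [sq, Complex.mul_re] at hre
    have h2 : 2 * (z.re * z.im) = 0 := by linarith
    rcases mul_eq_zero.mp h2 with h | h
    · norm_num at h
    rcases mul_eq_zero.mp h with h | h
    · linarith
    · rw [h, mul_zero, sub_zero] at hre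
      nlinarith [mul_self_nonneg z.re]
  · simp

/-- Every complex embedding sends a square root `x` of a negative rational to a purely imaginary number.
[folklore] -/
theorem conj_apply_sqrt {x : L} {a : ℚ} (hx : x ^ 2 = algebraMap ℚ L a) (ha : a < 0) (φ : L →+* ℂ) :
    starRingEnd ℂ (φ x) = -φ x := by
  refine conj_eq_neg_of_sq_lt_zero (a := (a : ℝ)) ?_ (by exact_mod_cast ha)
  rw [← map_pow, hx, eq_ratCast, map_ratCast, Complex.ofReal_ratCast]

/-- `x · y ∈ L⁺` (the maximal real subfield) for `x = √a`, `a < 0`, and `y ∈ K` anti-invariant under the complex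
conjugation of the CM field `K`. [cite: NeukirchANT1999, Ch. III §1] -/
theorem mul_mem_maximalRealSubfield [IsCMField K] {x : L} {a : ℚ} (hx : x ^ 2 = algebraMap ℚ L a) (ha : a < 0)
    {y : K} (hy : IsCMField.complexConj K y = -y) :
    x * algebraMap K L y ∈ maximalRealSubfield L := by
  rw [mem_maximalRealSubfield_iff]
  intro φ
  have h1 : star (φ x) = -φ x := by
    rw [← starRingEnd_apply]; exact conj_apply_sqrt hx ha φ
  have h2 : star (φ (algebraMap K L y)) = -φ (algebraMap K L y) := by
    have h := IsCMField.complexEmbedding_complexConj K (φ.comp (algebraMap K L)) y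
    rw [hy, map_neg, RingHom.comp_apply] at h
    rw [← starRingEnd_apply, ← h]
  rw [map_mul, star_mul', h1, h2, neg_mul_neg]

/-- There is `y ∈ K`, `y ≠ 0`, anti-invariant under the complex conjugation of a CM field `K`. [folklore] -/
theorem exists_complexConj_eq_neg (K : Type) [Field K] [NumberField K] [IsCMField K] :
    ∃ y : K, y ≠ 0 ∧ IsCMField.complexConj K y = -y := by
  have hne := IsCMField.complexConj_ne_one K
  obtain ⟨u, hu⟩ : ∃ u : K, IsCMField.complexConj K u ≠ u := by
    by_contra h
    exact hne (AlgEquiv.ext fun u ↦ not_not.mp (not_exists.mp h u))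
  refine ⟨u - IsCMField.complexConj K u, sub_ne_zero.mpr hu.symm, ?_⟩
  rw [map_sub, IsCMField.complexConj_apply_apply, neg_sub]

/-- `x ∉ L⁺`: a square root of a negative rational is moved by every complex conjugation. [folklore] -/
theorem sqrt_not_mem_maximalRealSubfield {x : L} {a : ℚ} (hx : x ^ 2 = algebraMap ℚ L a) (ha : a < 0) :
    x ∉ maximalRealSubfield L := by
  intro h
  rw [mem_maximalRealSubfield_iff] at h
  obtain ⟨φ⟩ : Nonempty (L →+* ℂ) := inferInstance
  have h1 := h φ
  have h2 : star (φ x) = -φ x := by rw [← starRingEnd_apply]; exact conj_apply_sqrt hx ha φ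
  rw [h2, neg_eq_iff_add_eq_zero, ← two_mul, mul_eq_zero] at h1
  rcases h1 with h1 | h1
  · norm_num at h1
  · have : (φ x) ^ 2 = (a : ℂ) := by rw [← map_pow, hx, eq_ratCast, map_ratCast]
    rw [h1, zero_pow two_ne_zero] at this
    exact ha.ne (by exact_mod_cast this.symm)

/-- **`L = K(√a)` is a CM field** (`K` CM, e.g. imaginary quadratic; `[L : K] = 2`; `x = √a ∉ K`, `a < 0`): `L` is
totally complex and `[L : L⁺] = 2`. [cite: NeukirchANT1999, Ch. III §1] -/
theorem isCMField (hK : IsImaginaryQuadratic K) (h2 : finrank K L = 2) {x : L} {a : ℚ}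
    (hx : x ^ 2 = algebraMap ℚ L a) (ha : a < 0) (hxK : x ∉ Set.range (algebraMap K L)) : IsCMField L := by
  haveI := hK.2
  haveI : IsCMField K := hK.isCMField
  haveI hL : IsTotallyComplex L := isTotallyComplex_of_tower (K := K)
  obtain ⟨y, hy0, hy⟩ := exists_complexConj_eq_neg K
  set z : L := x * algebraMap K L y with hz
  have hzmem : z ∈ maximalRealSubfield L := mul_mem_maximalRealSubfield hx ha hy
  -- `z ∉ ℚ` (indeed `z ∉ K`, as `x ∉ K` and `y ∈ Kˣ`)
  have hzK : z ∉ Set.range (algebraMap ℚ L) := by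
    rintro ⟨q, hq⟩
    apply hxK
    refine ⟨algebraMap ℚ K q * y⁻¹, ?_⟩
    rw [map_mul, ← IsScalarTower.algebraMap_apply, hq, hz, map_inv₀, mul_assoc,
      mul_inv_cancel₀ ((map_ne_zero _).mpr hy0), mul_one]
  -- hence `[L⁺ : ℚ] ≥ 2`
  have h4 : finrank ℚ L = 4 := finrank_eq_four hK h2
  have htower := Module.finrank_mul_finrank ℚ (maximalRealSubfield L) L
  rw [h4] at htower
  have hge : 2 ≤ finrank ℚ (maximalRealSubfield L) := by
    have hli : LinearIndependent ℚ ![(1 : maximalRealSubfield L), ⟨z, hzmem⟩] := by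
      refine LinearIndependent.of_comp (maximalRealSubfield L).subtype.toRatAlgHom.toLinearMap ?_
      have : ((maximalRealSubfield L).subtype.toRatAlgHom.toLinearMap ∘
          ![(1 : maximalRealSubfield L), ⟨z, hzmem⟩]) = ![(1 : L), z] := by
        ext i
        fin_cases i <;> rfl
      rw [this]
      exact Literature.NumberTheory.QuadraticFields.Quadratic.linearIndependent_one_pair hzK
    simpa using hli.fintype_card_le_finrank
  -- and `[L : L⁺] ≠ 1` since `x ∉ L⁺`
  have hne1 : finrank (maximalRealSubfield L) L ≠ 1 := by
    intro h1
    have hbot : (⊥ : Subalgebra (maximalRealSubfield L) L) = ⊤ :=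
      Subalgebra.bot_eq_top_iff_finrank_eq_one.mpr h1
    have hxmem : x ∈ (⊥ : Subalgebra (maximalRealSubfield L) L) := by rw [hbot]; exact Algebra.mem_top
    rw [Algebra.mem_bot] at hxmem
    obtain ⟨⟨x', hx'⟩, rfl⟩ := hxmem
    exact sqrt_not_mem_maximalRealSubfield hx ha hx'
  have hpos : 0 < finrank (maximalRealSubfield L) L := finrank_pos
  have hq : finrank (maximalRealSubfield L) L = 2 := by
    have hle : finrank (maximalRealSubfield L) L ≤ 2 := by nlinarith
    interval_cases (finrank (maximalRealSubfield L) L) <;> omega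
  haveI hQ : Algebra.IsQuadraticExtension (maximalRealSubfield L) L := { finrank_eq_two' := hq }
  exact IsCMField.mk (to_isTotallyComplex := hL) (is_quadratic := hQ)

/-- **The complex conjugation of `L` restricts to that of `K`**: `c_L(k) = c_K(k)` for `k ∈ K` (both are read through
any complex embedding). [cite: NeukirchANT1999, Ch. III §1] -/
theorem complexConj_algebraMap [IsCMField K] [IsCMField L] (k : K) :
    IsCMField.complexConj L (algebraMap K L k) = algebraMap K L (IsCMField.complexConj K k) := by
  obtain ⟨φ⟩ : Nonempty (L →+* ℂ) := inferInstance
  apply φ.injective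
  have h := IsCMField.complexEmbedding_complexConj K (φ.comp (algebraMap K L)) k
  simp only [RingHom.comp_apply] at h
  rw [IsCMField.complexEmbedding_complexConj, h]

/-- **The complex conjugation of `L` negates `x = √a`**, `a < 0`. [folklore] -/
theorem complexConj_sqrt [IsCMField L] {x : L} {a : ℚ} (hx : x ^ 2 = algebraMap ℚ L a) (ha : a < 0) :
    IsCMField.complexConj L x = -x := by
  obtain ⟨φ⟩ : Nonempty (L →+* ℂ) := inferInstance
  apply φ.injective
  rw [IsCMField.complexEmbedding_complexConj, map_neg]
  exact conj_apply_sqrt hx ha φ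

end Summit.BirchSwinnertonDyer.BirchSwinnertonDyer.Theorems.BiquadraticEisensteinDescentEisensteinHeartFlatCMInertBadKPrimeBiquadraticCMField

end
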